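import Literature.NumberTheory.EllipticCurves.BinaryQuarticInvariantCountProofs
import Literature.NumberTheory.EllipticCurves.BinaryQuarticTwoCoverDescentProofs
import Literature.NumberTheory.EllipticCurves.BinaryQuarticStabilizerTorsion
import Mathlib.LinearAlgebra.Matrix.GeneralLinearGroup.Card
import HarnessLib

/-!
# Every binary quartic form with `Δ ≠ 0` over a finite field of characteristic `≠ 2, 3` is soluble
# (the genus-one input of Bhargava–Shankar's Prop. 5.13 / Prop. 3.18, without Hasse–Weil)

`Proofs` companion (theorems only: no definitions, no named facts) of `BinaryQuarticForms.lean`.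

Source and role. M. Bhargava, A. Shankar, *Binary quartic forms having bounded invariants, and the
boundedness of the average rank of elliptic curves*, Ann. of Math. (2) 181 (2015) 191–242. In the
proof of the local solubility / uniformity input of Theorem 1.1 (Prop. 5.13 of the held arXiv text
`arXiv:1006.1002v2`; Prop. 3.18 of the published version) one needs that an integral form `f` with
`p ∤ Δ(f)` is `ℚ_p`-soluble ("see [Cremona, *Algorithms*]"): the reduction of `z² = f(x,y)` is a
smooth curve of genus one over `𝔽_p`, which has a rational point, and Hensel's lemma lifts it. The
standard argument for the existence of the `𝔽_p`-point is the Hasse–Weil bound, unavailable in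
Mathlib. This file proves the existence of the point by an elementary *global* count instead:

* `BinaryQuartic.isSoluble_of_disc_ne_zero_of_finite`: **for a finite field `F` with `2 ≠ 0`,
  `3 ≠ 0` and every `f ∈ V_F` with `Δ(f) ≠ 0`, the equation `z² = f(x, y)` has a solution with
  `(x, y) ≠ (0, 0)`.**

## The argument

Fix `(I, J) = (I(f₀), J(f₀))`, `4I³ ≠ J²`, and let `X = {f : I(f) = I, J(f) = J}`, `q = #F`.
1. `#X = q³ − q` (`BinaryQuartic.natCard_invariants_eq`, `BinaryQuarticInvariantCountProofs`).
2. For every `f ∈ X` the stabiliser of `f` in `GL₂(F)` for the twisted action has `(q − 1) · s`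
   elements, `s = 1 + #{φ ∈ F : φ³ − 3Iφ + J = 0}` (Bhargava–Shankar's Lemma 5.11,
   `BinaryQuartic.pgl2StabilizerCard_eq`, and the count of scalars in each class:
   `card_stabilizer_eq`), so by orbit–stabiliser every orbit in `X` has `(q³ − q)/s` elements
   (`card_orbit_mul_pgl2StabilizerCard`).
3. `s = #E'(F)[2] = #(E'(F)/2E'(F))` for `E' = E'_{I,J} : Y² = X³ − 27IX − 27J`
   (`natCard_torsionBy_two_cremona`, `natCard_quotient_range_eq_natCard_ker`).
4. The soluble forms `y(x³ − (I/3)xy² − (J/27)y³)` and `x⁴ − (ξ/6)x²y² + (η/27)xy³ + …`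
   (`(ξ, η) ∈ E'(F)`) lie in `X`, and two of them in the same orbit have base points congruent
   modulo `2E'(F)` (`BinaryQuarticTwoCoverDescentProofs`: `exists_basePoint_sub_eq_add_self`,
   `exists_basePoint_eq_add_self_of_twist_a_eq_zero`). Hence there are at least `s` pairwise
   distinct *soluble* orbits in `X`; as they are disjoint of size `(q³ − q)/s` each, they exhaust
   `X`, and `f₀ ∈ X` is soluble (solubility is an invariant of the twisted action,
   `IsSoluble.twist`).

In particular (step 4 with equality) the soluble classes with invariants `(I, J)` are in bijection
with `E'(F)/2E'(F)` — Bhargava–Shankar's Lemma 5.10 over finite fields — and *every* class is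
soluble, the finite-field case of the triviality of `2`-coverings (Lang). The `p`-adic corollary
(`p ∤ Δ(f) ⇒ f` is `ℚ_p`-soluble, `p ≥ 5`) is in `BinaryQuarticGoodReductionSolubilityProofs.lean`.

## References

* M. Bhargava, A. Shankar, Ann. of Math. (2) 181 (2015) 191–242 = arXiv:1006.1002, Prop. 5.13 and
  Lemmas 5.10–5.11 of the arXiv v2 text (Prop. 3.18, Thm 3.2 of the published version).
  [cite: BhargavaShankarAnnals2015, Prop. 5.13 (arXiv:1006.1002v2 numbering)]
* J. E. Cremona, *Classical invariants and 2-descent on elliptic curves*, J. Symbolic Comput. 31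
  (2001) 71–87, Prop. 4.2–4.3. [cite: Cremona2001, Prop. 4.2–4.3]
-/

noncomputable section

open scoped Classical

namespace Literature.NumberTheory.EllipticCurves

namespace BinaryQuartic

variable {F : Type*} [Field F]

/-! ## Solubility is an invariant of the twisted action -/

/-- A point of `C_f` gives a point of `C_{γ·f}`: solubility is invariant under the twisted action
of `GL₂`. [cite: BhargavaShankarAnnals2015, §5.2 (K-solubility of K-equivalence classes; arXiv:1006.1002v2 numbering)] -/
theorem IsSoluble.twist {f : BinaryQuartic F} (hf : f.IsSoluble) {γ : Matrix (Fin 2) (Fin 2) F}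
    (hγ : γ.det ≠ 0) : (twist γ f).IsSoluble := by
  obtain ⟨x, y, z, hxy, hz⟩ := hf
  have hu : IsUnit γ.det := isUnit_iff_ne_zero.mpr hγ
  -- `(x', y') = (x, y) γ⁻¹`
  set x' := x * γ⁻¹ 0 0 + y * γ⁻¹ 1 0 with hx'
  set y' := x * γ⁻¹ 0 1 + y * γ⁻¹ 1 1 with hy'
  have hrow : x' * γ 0 0 + y' * γ 1 0 = x ∧ x' * γ 0 1 + y' * γ 1 1 = y := by
    have hinv : γ⁻¹ * γ = 1 := Matrix.nonsing_inv_mul γ hu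
    have h00 := congr_fun (congr_fun hinv 0) 0
    have h01 := congr_fun (congr_fun hinv 0) 1
    have h10 := congr_fun (congr_fun hinv 1) 0
    have h11 := congr_fun (congr_fun hinv 1) 1
    simp only [Matrix.mul_apply, Fin.sum_univ_two, Matrix.one_apply_eq, Matrix.one_apply_ne,
      ne_eq, zero_ne_one, not_false_eq_true, one_ne_zero] at h00 h01 h10 h11
    constructor
    · rw [hx', hy']; linear_combination x * h00 + y * h10
    · rw [hx', hy']; linear_combination x * h01 + y * h11
  refine ⟨x', y', z / γ.det, ?_, ?_⟩
  · by_contra h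
    simp only [not_or, not_not] at h
    obtain ⟨h1, h2⟩ := h
    rw [h1, h2] at hrow
    simp only [zero_mul, add_zero] at hrow
    rcases hxy with hx | hy
    · exact hx hrow.1.symm
    · exact hy hrow.2.symm
  · apply sq_div_det_eq_eval_twist hγ
    rw [hrow.1, hrow.2, hz]

/-- A form with `a = 0` is soluble (`(x, y, z) = (1, 0, 0)`), and so is a form with `a = 1`
(`(1, 0, 1)`). [folklore] -/
theorem isSoluble_of_a_eq_zero_or_one {f : BinaryQuartic F} (h : f.a = 0 ∨ f.a = 1) :
    f.IsSoluble := by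
  rcases h with h | h
  · exact ⟨1, 0, 0, Or.inl one_ne_zero, by simp [BinaryQuartic.eval, h]⟩
  · exact ⟨1, 0, 1, Or.inl one_ne_zero, by simp [BinaryQuartic.eval, h]⟩

/-! ## Counting: stabilisers, orbits, `GL₂(F)` -/

section Finite

variable [Fintype F]

/-- `#GL₂(F) = (q² − 1)(q² − q)`, for the set of matrices with nonzero determinant. [folklore] -/
theorem card_filter_det_ne_zero :
    (Finset.univ.filter fun γ : Matrix (Fin 2) (Fin 2) F ↦ γ.det ≠ 0).card =
      (Fintype.card F ^ 2 - 1) * (Fintype.card F ^ 2 - Fintype.card F) := by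
  have e : GL (Fin 2) F ≃ {γ : Matrix (Fin 2) (Fin 2) F // γ.det ≠ 0} :=
    { toFun := fun g ↦ ⟨g.val, fun h ↦ by
        have := g.det_ne_zero
        exact this h⟩
      invFun := fun γ ↦ Matrix.GeneralLinearGroup.mkOfDetNeZero γ.1 γ.2
      left_inv := fun g ↦ by ext; rfl
      right_inv := fun γ ↦ by rfl }
  rw [← Fintype.card_subtype, ← Nat.card_eq_fintype_card, ← Nat.card_congr e,
    Matrix.card_GL_field]
  simp [Fin.prod_univ_two]

/-- **The stabiliser of `f` in `GL₂(F)` has `(q − 1) · #Stab_{PGL₂(F)}(f)` elements**: each class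
modulo scalars consists of the `q − 1` nonzero multiples of one matrix. [cite: BhargavaShankarAnnals2015, Lemma 5.11 (arXiv:1006.1002v2 numbering)] -/
theorem card_stabilizer_eq (f : BinaryQuartic F) :
    (Finset.univ.filter fun γ : Matrix (Fin 2) (Fin 2) F ↦ γ.det ≠ 0 ∧ twist γ f = f).card =
      (Fintype.card F - 1) * pgl2StabilizerCard f := by
  set S := Finset.univ.filter fun γ : Matrix (Fin 2) (Fin 2) F ↦ γ.det ≠ 0 ∧ twist γ f = f
    with hS
  have hSmem : ∀ γ, γ ∈ S ↔ γ ∈ stabilizerSet f := fun γ ↦ by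
    simp only [hS, Finset.mem_filter, Finset.mem_univ, true_and, stabilizerSet, Set.mem_setOf_eq]
  have hcoe : (S : Set (Matrix (Fin 2) (Fin 2) F)) = stabilizerSet f := by
    ext γ; exact hSmem γ
  -- `pgl2StabilizerCard f` is the number of classes
  have hcls : pgl2StabilizerCard f = (S.image (stabilizerClass f)).card := by
    rw [pgl2StabilizerCard, ← hcoe, ← Finset.coe_image, Set.ncard_coe_finset]
  rw [hcls, Finset.card_eq_sum_card_fiberwise (f := stabilizerClass f) (t := S.image
    (stabilizerClass f)) (fun γ hγ ↦ Finset.mem_coe.mpr (Finset.mem_image_of_mem _ hγ))]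
  rw [Finset.sum_const_nat (m := Fintype.card F - 1) fun C hC ↦ ?_]
  · ring
  -- the fibre over the class of `γ₀` is `{c • γ₀ : c ≠ 0}`
  obtain ⟨γ₀, hγ₀, rfl⟩ := Finset.mem_image.mp hC
  have hγ₀' : γ₀ ∈ stabilizerSet f := (hSmem γ₀).mp hγ₀
  have hγ₀ne : γ₀ ≠ 0 := by
    intro h; apply hγ₀'.1; rw [h, Matrix.det_zero]
  have hfib : S.filter (fun γ ↦ stabilizerClass f γ = stabilizerClass f γ₀) =
      (Finset.univ.filter fun c : F ↦ c ≠ 0).image fun c ↦ c • γ₀ := by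
    ext γ
    simp only [Finset.mem_filter, Finset.mem_image, Finset.mem_univ, true_and]
    constructor
    · rintro ⟨hγ, hcl⟩
      obtain ⟨c, hc, hcγ⟩ := exists_smul_of_stabilizerClass_eq hγ₀' hcl
      refine ⟨c⁻¹, inv_ne_zero hc, ?_⟩
      rw [hcγ, smul_smul, inv_mul_cancel₀ hc, one_smul]
    · rintro ⟨c, hc, rfl⟩
      exact ⟨(hSmem _).mpr ((smul_mem_stabilizerSet_iff hc f γ₀).mpr hγ₀'),
        stabilizerClass_smul f hc γ₀⟩
  rw [hfib, Finset.card_image_of_injective _ fun c c' (h : c • γ₀ = c' • γ₀) ↦ ?_,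
    Finset.filter_ne' Finset.univ (0 : F), Finset.card_erase_of_mem (Finset.mem_univ _),
    Finset.card_univ]
  -- `c ↦ c • γ₀` is injective as `γ₀ ≠ 0`
  by_contra hcc
  apply hγ₀ne
  have h' : (c - c') • γ₀ = 0 := by rw [sub_smul, h, sub_self]
  exact (smul_eq_zero.mp h').resolve_left (sub_ne_zero.mpr hcc)

/-- **Orbit–stabiliser for the twisted action of `GL₂(F)` on `V_F`.** [folklore] -/
theorem card_orbit_mul_card_stabilizer (f : BinaryQuartic F) :
    ((Finset.univ.filter fun γ : Matrix (Fin 2) (Fin 2) F ↦ γ.det ≠ 0).image fun γ ↦ twist γ f).card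
      * (Finset.univ.filter fun γ : Matrix (Fin 2) (Fin 2) F ↦ γ.det ≠ 0 ∧ twist γ f = f).card =
      (Finset.univ.filter fun γ : Matrix (Fin 2) (Fin 2) F ↦ γ.det ≠ 0).card := by
  set G := Finset.univ.filter fun γ : Matrix (Fin 2) (Fin 2) F ↦ γ.det ≠ 0 with hG
  set S := Finset.univ.filter fun γ : Matrix (Fin 2) (Fin 2) F ↦ γ.det ≠ 0 ∧ twist γ f = f
    with hS
  rw [Finset.card_eq_sum_card_fiberwise (f := fun γ ↦ twist γ f) (s := G)
    (t := G.image fun γ ↦ twist γ f) (fun γ hγ ↦ Finset.mem_coe.mpr (Finset.mem_image_of_mem _ hγ))]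
  rw [Finset.sum_const_nat (m := S.card) fun g hg ↦ ?_, mul_comm]
  obtain ⟨γ₀, hγ₀, rfl⟩ := Finset.mem_image.mp hg
  have hγ₀d : γ₀.det ≠ 0 := (Finset.mem_filter.mp hγ₀).2
  have hu : IsUnit γ₀.det := isUnit_iff_ne_zero.mpr hγ₀d
  -- the fibre over `γ₀ · f` is `γ₀ · Stab(f)`
  have hfib : G.filter (fun γ ↦ twist γ f = twist γ₀ f) = S.image fun σ ↦ γ₀ * σ := by
    ext γ
    simp only [hG, hS, Finset.mem_filter, Finset.mem_image, Finset.mem_univ, true_and]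
    constructor
    · rintro ⟨hγ, hγf⟩
      refine ⟨γ₀⁻¹ * γ, ⟨?_, ?_⟩, Matrix.mul_nonsing_inv_cancel_left _ _ hu⟩
      · rw [Matrix.det_mul]
        exact mul_ne_zero (Matrix.isUnit_nonsing_inv_det _ hu).ne_zero hγ
      · rw [twist_mul, hγf, twist_inv_twist hγ₀d]
    · rintro ⟨σ, ⟨hσ, hσf⟩, rfl⟩
      exact ⟨by rw [Matrix.det_mul]; exact mul_ne_zero hγ₀d hσ, by rw [twist_mul, hσf]⟩
  rw [hfib, Finset.card_image_of_injective _ fun σ σ' (h : γ₀ * σ = γ₀ * σ') ↦ ?_]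
  calc σ = γ₀⁻¹ * (γ₀ * σ) := (Matrix.nonsing_inv_mul_cancel_left _ _ hu).symm
    _ = γ₀⁻¹ * (γ₀ * σ') := by rw [h]
    _ = σ' := Matrix.nonsing_inv_mul_cancel_left _ _ hu

/-- **Every orbit with `Δ ≠ 0` has `(q³ − q)/#Stab_{PGL₂}(f)` elements**:
`#(GL₂(F) · f) · #Stab_{PGL₂(F)}(f) = q³ − q`. [cite: BhargavaShankarAnnals2015, Lemma 5.11 (arXiv:1006.1002v2 numbering)] -/
theorem card_orbit_mul_pgl2StabilizerCard (f : BinaryQuartic F) :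
    ((Finset.univ.filter fun γ : Matrix (Fin 2) (Fin 2) F ↦ γ.det ≠ 0).image fun γ ↦ twist γ f).card
      * pgl2StabilizerCard f = Fintype.card F ^ 3 - Fintype.card F := by
  have h := card_orbit_mul_card_stabilizer f
  rw [card_stabilizer_eq, card_filter_det_ne_zero] at h
  obtain ⟨n, hn⟩ : ∃ n, Fintype.card F = n + 1 := ⟨Fintype.card F - 1, by
    have := Fintype.card_pos (α := F); omega⟩
  have hnpos : 0 < n := by have := Fintype.one_lt_card (α := F); omega
  rw [hn, Nat.add_sub_cancel] at h
  rw [hn]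
  -- `(q² − 1)(q² − q) = (q − 1) · (q³ − q)` with `q = n + 1`
  have e1 : (n + 1) ^ 2 - 1 = n * (n + 2) := by
    rw [show (n + 1) ^ 2 = n * (n + 2) + 1 by ring, Nat.add_sub_cancel]
  have e2 : (n + 1) ^ 2 - (n + 1) = n * (n + 1) := by
    rw [show (n + 1) ^ 2 = n * (n + 1) + (n + 1) by ring, Nat.add_sub_cancel]
  have e3 : (n + 1) ^ 3 - (n + 1) = n * (n + 1) * (n + 2) := by
    rw [show (n + 1) ^ 3 = n * (n + 1) * (n + 2) + (n + 1) by ring, Nat.add_sub_cancel]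
  rw [e1, e2] at h
  rw [e3]
  apply Nat.eq_of_mul_eq_mul_left hnpos
  calc n * (((Finset.univ.filter fun γ : Matrix (Fin 2) (Fin 2) F ↦ γ.det ≠ 0).image
          fun γ ↦ twist γ f).card * pgl2StabilizerCard f)
        = ((Finset.univ.filter fun γ : Matrix (Fin 2) (Fin 2) F ↦ γ.det ≠ 0).image
            fun γ ↦ twist γ f).card * (n * pgl2StabilizerCard f) := by ring
    _ = n * (n + 2) * (n * (n + 1)) := h
    _ = n * (n * (n + 1) * (n + 2)) := by ring

omit [Fintype F] in
/-- The number of elements of the stabiliser in `PGL₂(F)` depends only on the invariants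
(it is `1 + #{φ : φ³ − 3Iφ + J = 0}`). [cite: BhargavaShankarAnnals2015, Lemma 5.11 (arXiv:1006.1002v2 numbering)] -/
theorem pgl2StabilizerCard_eq_of_invariants_eq (h2 : (2 : F) ≠ 0) (h3 : (3 : F) ≠ 0)
    {f g : BinaryQuartic F} (hf : f.disc ≠ 0) (hg : g.disc ≠ 0) (hI : g.I = f.I) (hJ : g.J = f.J) :
    pgl2StabilizerCard g = pgl2StabilizerCard f := by
  rw [pgl2StabilizerCard_eq h2 h3 hf, pgl2StabilizerCard_eq h2 h3 hg]
  simp only [resolventRoots, hI, hJ]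

end Finite

/-! ## `#(E'(F)/2E'(F)) = #E'(F)[2] = #Stab_{PGL₂(F)}(f)` -/

/-- The affine points of a Weierstrass curve over a finite field form a finite group. [folklore] -/
theorem finite_point [Finite F] (W : WeierstrassCurve F) : Finite W.toAffine.Point := by
  refine Finite.of_injective (fun P : W.toAffine.Point ↦ match P with
    | .zero => (none : Option (F × F))
    | .some x y _ => some (x, y)) ?_
  intro P Q h
  rcases P with _ | ⟨x, y, hP⟩ <;> rcases Q with _ | ⟨x', y', hQ⟩
  · rfl
  · simp at h
  · simp at h
  · simp only [Option.some.injEq, Prod.mk.injEq] at h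
    obtain ⟨rfl, rfl⟩ := h
    rfl

/-- For a finite abelian group `G`, `#(G/2G) = #G[2]` (both equal `#G/#2G`). [folklore] -/
theorem natCard_quotient_range_eq_natCard_ker {G : Type*} [AddCommGroup G] [Finite G] (φ : G →+ G) :
    Nat.card (G ⧸ φ.range) = Nat.card φ.ker := by
  have h1 := AddSubgroup.card_eq_card_quotient_mul_card_addSubgroup φ.range
  have h2 := AddSubgroup.card_eq_card_quotient_mul_card_addSubgroup φ.ker
  have h3 : Nat.card (G ⧸ φ.ker) = Nat.card φ.range :=
    Nat.card_congr (QuotientAddGroup.quotientKerEquivRange φ).toEquiv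
  rw [h3] at h2
  rw [h1, mul_comm] at h2
  have hpos : 0 < Nat.card φ.range := Nat.card_pos
  exact Nat.eq_of_mul_eq_mul_left hpos h2

/-- **`#E'_{I,J}(F)[2] = #Stab_{PGL₂(F)}(f)`** for `f` with invariants `(I, J)` and `Δ(f) ≠ 0`: the
`2`-torsion of `Y² = X³ − 27IX − 27J` is `O` and the roots `X = −3φ` of the resolvent
`φ³ − 3Iφ + J` (Bhargava–Shankar, Lemma 5.11, on the integral model). [cite: BhargavaShankarAnnals2015, Lemma 5.11 (arXiv:1006.1002v2 numbering)] -/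
theorem natCard_torsionBy_two_cremona (h2 : (2 : F) ≠ 0) (h3 : (3 : F) ≠ 0) {f : BinaryQuartic F}
    (hΔ : f.disc ≠ 0) {I J : F} (hI : f.I = I) (hJ : f.J = J) :
    Nat.card (AddSubgroup.torsionBy
        (⟨0, 0, 0, -27 * I, -27 * J⟩ : WeierstrassCurve F).toAffine.Point (2 : ℤ)) =
      pgl2StabilizerCard f := by
  have hIJ : 4 * I ^ 3 - J ^ 2 ≠ 0 := by
    rw [← hI, ← hJ]; exact four_I_cube_sub_J_sq_ne_zero hΔ h3
  haveI := cremona_isElliptic h2 h3 hIJ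
  rw [WeierstrassCurve.natCard_torsionBy_two_eq _ h2, pgl2StabilizerCard_eq h2 h3 hΔ, add_comm]
  congr 1
  have hroots : {x : F | (⟨0, 0, 0, -27 * I, -27 * J⟩ : WeierstrassCurve F).twoTorsionPolynomial.toPoly.IsRoot x}
      = (fun φ : F ↦ -3 * φ) '' resolventRoots f := by
    ext x
    rw [Set.mem_setOf_eq, WeierstrassCurve.isRoot_twoTorsionPolynomial_short_iff h2]
    simp only [resolventRoots, Set.mem_image, Set.mem_setOf_eq, hI, hJ]
    constructor
    · intro h
      refine ⟨-x / 3, ?_, by field_simp⟩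
      field_simp
      linear_combination -h
    · rintro ⟨φ, hφ, rfl⟩
      linear_combination (-27) * hφ
  rw [hroots, Set.ncard_image_of_injective _ fun φ φ' h ↦ ?_]
  have : (-3 : F) * (φ - φ') = 0 := by linear_combination h
  exact sub_eq_zero.mp ((mul_eq_zero.mp this).resolve_left (neg_ne_zero.mpr h3))

/-! ## The soluble representatives `f_O`, `f_P` and their invariants -/

/-- Numeral bookkeeping: `6, 12, 27, 36 ≠ 0`. [folklore] -/
theorem six_twelve_ne_zero (h2 : (2 : F) ≠ 0) (h3 : (3 : F) ≠ 0) :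
    (6 : F) ≠ 0 ∧ (12 : F) ≠ 0 ∧ (27 : F) ≠ 0 := by
  refine ⟨?_, ?_, ?_⟩
  · rw [show (6 : F) = 2 * 3 by norm_num]; exact mul_ne_zero h2 h3
  · rw [show (12 : F) = 2 * 2 * 3 by norm_num]; exact mul_ne_zero (mul_ne_zero h2 h2) h3
  · rw [show (27 : F) = 3 * 3 * 3 by norm_num]; exact mul_ne_zero (mul_ne_zero h3 h3) h3

/-- `f_O = x³y − (I/3)xy³ − (J/27)y⁴` has invariants `(I, J)`. [cite: BhargavaShankarAnnals2015, Lemma 5.10 (arXiv:1006.1002v2 numbering)] -/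
theorem invariants_trivialQuartic (h3 : (3 : F) ≠ 0) (I J : F) :
    (⟨0, 1, 0, -I / 3, -J / 27⟩ : BinaryQuartic F).I = I ∧
      (⟨0, 1, 0, -I / 3, -J / 27⟩ : BinaryQuartic F).J = J := by
  have h27 : (27 : F) ≠ 0 := by
    rw [show (27 : F) = 3 * 3 * 3 by norm_num]; exact mul_ne_zero (mul_ne_zero h3 h3) h3
  constructor
  · simp only [BinaryQuartic.I]; field_simp; ring
  · simp only [BinaryQuartic.J]; field_simp; ring

/-- `f_P = x⁴ − (ξ/6)x²y² + (η/27)xy³ + ((I − ξ²/36)/12)y⁴` has invariants `(I, J)` when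
`(ξ, η) ∈ E'_{I,J}(F)`. [cite: BhargavaShankarAnnals2015, Lemma 5.10 (arXiv:1006.1002v2 numbering)] -/
theorem invariants_quarticOfPoint' (h2 : (2 : F) ≠ 0) (h3 : (3 : F) ≠ 0) {I J ξ η : F}
    (hP : η ^ 2 = ξ ^ 3 - 27 * I * ξ - 27 * J) :
    (⟨1, 0, -ξ / 6, η / 27, (I - (ξ / 6) ^ 2) / 12⟩ : BinaryQuartic F).I = I ∧
      (⟨1, 0, -ξ / 6, η / 27, (I - (ξ / 6) ^ 2) / 12⟩ : BinaryQuartic F).J = J := by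
  obtain ⟨h6, h12, h27⟩ := six_twelve_ne_zero h2 h3
  constructor
  · simp only [BinaryQuartic.I]; field_simp; ring
  · simp only [BinaryQuartic.J]; field_simp; linear_combination (-2592) * hP

/-- The base point of `f_P` is `P`: `(−6c, 27d) = (ξ, η)`. [cite: Cremona2001, Prop. 4.2] -/
theorem basePoint_quarticOfPoint' (h2 : (2 : F) ≠ 0) (h3 : (3 : F) ≠ 0) (I ξ η : F) :
    -6 * (⟨1, 0, -ξ / 6, η / 27, (I - (ξ / 6) ^ 2) / 12⟩ : BinaryQuartic F).c = ξ ∧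
      27 * (⟨1, 0, -ξ / 6, η / 27, (I - (ξ / 6) ^ 2) / 12⟩ : BinaryQuartic F).d = η := by
  obtain ⟨h6, h12, h27⟩ := six_twelve_ne_zero h2 h3
  constructor
  · field_simp
  · field_simp

/-! ## The main theorem -/

section Main

variable [Fintype F]

/-- **Every binary quartic form with nonzero discriminant over a finite field in which `2 ≠ 0` and
`3 ≠ 0` is soluble**: `z² = f(x, y)` has a solution with `(x, y) ≠ (0, 0)`. This is the input
"the reduction of `z² = f` modulo `p ∤ Δ(f)` has an `𝔽_p`-point" of Bhargava–Shankar's Prop. 5.13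
(Prop. 3.18 of the published version), proved here by counting instead of the Hasse–Weil bound.
[cite: BhargavaShankarAnnals2015, Prop. 5.13 (arXiv:1006.1002v2 numbering)] -/
theorem isSoluble_of_disc_ne_zero_of_finite (h2 : (2 : F) ≠ 0) (h3 : (3 : F) ≠ 0)
    {f₀ : BinaryQuartic F} (hΔ : f₀.disc ≠ 0) : f₀.IsSoluble := by
  obtain ⟨h6, h12, h27⟩ := six_twelve_ne_zero h2 h3
  set I := f₀.I with hIdef
  set J := f₀.J with hJdef
  have hIJ : 4 * I ^ 3 - J ^ 2 ≠ 0 := four_I_cube_sub_J_sq_ne_zero hΔ h3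
  -- the curve `E' = E'_{I,J}` and the quotient `E'(F)/2E'(F)`
  set W : WeierstrassCurve F := ⟨0, 0, 0, -27 * I, -27 * J⟩ with hW
  haveI hell : W.IsElliptic := cremona_isElliptic h2 h3 hIJ
  haveI : Finite W.toAffine.Point := finite_point W
  set φ : W.toAffine.Point →+ W.toAffine.Point := zsmulAddGroupHom 2 with hφ
  set T := W.toAffine.Point ⧸ φ.range
  haveI : Finite T := Quotient.finite _
  letI : Fintype T := Fintype.ofFinite T
  -- `s = #T = #Stab_{PGL₂}(f₀)`
  set s := pgl2StabilizerCard f₀ with hs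
  have hTcard : Fintype.card T = s := by
    have hker : φ.ker = AddSubgroup.torsionBy W.toAffine.Point 2 := by
      ext P
      rw [AddMonoidHom.mem_ker, hφ, zsmulAddGroupHom_apply, AddSubgroup.torsionBy,
        Submodule.mem_toAddSubgroup, Submodule.mem_torsionBy_iff]
    rw [← Nat.card_eq_fintype_card, natCard_quotient_range_eq_natCard_ker φ, hker, hs]
    exact natCard_torsionBy_two_cremona h2 h3 hΔ hIdef.symm hJdef.symm
  -- the set `X` of forms with invariants `(I, J)`
  set X := Finset.univ.filter fun f : BinaryQuartic F ↦ f.I = I ∧ f.J = J with hX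
  have hXcard : X.card = Fintype.card F ^ 3 - Fintype.card F := by
    rw [hX, ← Fintype.card_subtype, ← Nat.card_eq_fintype_card]
    exact natCard_invariants_eq h2 h3 hIJ
  have hXdisc : ∀ f ∈ X, f.disc ≠ 0 := fun f hf ↦ by
    obtain ⟨hfI, hfJ⟩ := (Finset.mem_filter.mp hf).2
    intro h
    apply hIJ
    rw [← hfI, ← hfJ, ← twentySeven_mul_disc, h, mul_zero]
  -- orbits
  set G := Finset.univ.filter fun γ : Matrix (Fin 2) (Fin 2) F ↦ γ.det ≠ 0 with hG
  have hOrbX : ∀ f ∈ X, (G.image fun γ ↦ twist γ f) ⊆ X := fun f hf g hg ↦ by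
    obtain ⟨γ, hγ, rfl⟩ := Finset.mem_image.mp hg
    have hγd : γ.det ≠ 0 := (Finset.mem_filter.mp hγ).2
    obtain ⟨hfI, hfJ⟩ := (Finset.mem_filter.mp hf).2
    exact Finset.mem_filter.mpr ⟨Finset.mem_univ _, by rw [I_twist hγd, hfI],
      by rw [J_twist hγd, hfJ]⟩
  have hOrbCard : ∀ f ∈ X, (G.image fun γ ↦ twist γ f).card * s =
      Fintype.card F ^ 3 - Fintype.card F := fun f hf ↦ by
    obtain ⟨hfI, hfJ⟩ := (Finset.mem_filter.mp hf).2
    have hpg : pgl2StabilizerCard f = s := by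
      rw [hs]
      exact pgl2StabilizerCard_eq_of_invariants_eq h2 h3 hΔ (hXdisc f hf) (hfI.trans hIdef)
        (hfJ.trans hJdef)
    rw [← hpg]
    exact card_orbit_mul_pgl2StabilizerCard f
  -- soluble representatives indexed by the points of `E'(F)`
  let rep : W.toAffine.Point → BinaryQuartic F := fun P ↦ match P with
    | .zero => ⟨0, 1, 0, -I / 3, -J / 27⟩
    | .some ξ η _ => ⟨1, 0, -ξ / 6, η / 27, (I - (ξ / 6) ^ 2) / 12⟩
  have hrepX : ∀ P, rep P ∈ X := by
    rintro (_ | ⟨ξ, η, hP⟩)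
    · exact Finset.mem_filter.mpr ⟨Finset.mem_univ _, invariants_trivialQuartic h3 I J⟩
    · have hP' : η ^ 2 = ξ ^ 3 - 27 * I * ξ - 27 * J := (cremona_equation_iff I J ξ η).mp hP.1
      exact Finset.mem_filter.mpr ⟨Finset.mem_univ _, invariants_quarticOfPoint' h2 h3 hP'⟩
  have hrepSol : ∀ P, (rep P).IsSoluble := by
    rintro (_ | ⟨ξ, η, hP⟩)
    · exact isSoluble_of_a_eq_zero_or_one (Or.inl rfl)
    · exact isSoluble_of_a_eq_zero_or_one (Or.inr rfl)
  -- two representatives in the same orbit are congruent modulo `2E'(F)`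
  have hmonic : ∀ (ξ η : F) (hP : W.toAffine.Nonsingular ξ η),
      ∃ h₀ : W.toAffine.Nonsingular (-6 * (rep (.some _ _ hP)).c) (27 * (rep (.some _ _ hP)).d),
        (.some _ _ h₀ : W.toAffine.Point) = .some _ _ hP := by
    intro ξ η hP
    obtain ⟨hc, hd⟩ := basePoint_quarticOfPoint' h2 h3 I ξ η
    refine ⟨by rw [hc, hd]; exact hP, ?_⟩
    simp only [WeierstrassCurve.Affine.Point.some.injEq]
    exact ⟨hc, hd⟩
  have hsep0 : ∀ (ξ η : F) (hP : W.toAffine.Nonsingular ξ η) (γ : Matrix (Fin 2) (Fin 2) F),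
      γ.det ≠ 0 → (twist γ (rep (.some _ _ hP))).a = 0 →
        (QuotientAddGroup.mk (.some _ _ hP) : T) = QuotientAddGroup.mk 0 := by
    intro ξ η hP γ hγ h0
    obtain ⟨h₀, hQ⟩ := hmonic ξ η hP
    have hinv := invariants_quarticOfPoint' h2 h3 ((cremona_equation_iff I J ξ η).mp hP.1)
    obtain ⟨R, hR⟩ := exists_basePoint_eq_add_self_of_twist_a_eq_zero h2 h3 hIJ rfl rfl
      hinv.1 hinv.2 hγ h0 h₀
    rw [QuotientAddGroup.eq]
    refine ⟨-R, ?_⟩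
    rw [hφ, zsmulAddGroupHom_apply, two_zsmul, ← neg_add, ← hR, hQ, add_zero]
  have hsep : ∀ P P' (γ : Matrix (Fin 2) (Fin 2) F), γ.det ≠ 0 → twist γ (rep P) = rep P' →
      (QuotientAddGroup.mk P : T) = QuotientAddGroup.mk P' := by
    rintro (_ | ⟨ξ, η, hP⟩) (_ | ⟨ξ', η', hP'⟩) γ hγ h
    · rfl
    · -- `f_O ∼ f_{P'}`: apply the previous case to `γ⁻¹`
      have hγ' : γ⁻¹.det ≠ 0 :=
        (Matrix.isUnit_nonsing_inv_det _ (isUnit_iff_ne_zero.mpr hγ)).ne_zero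
      have h' : (twist γ⁻¹ (rep (.some _ _ hP'))).a = 0 := by
        rw [← h, twist_inv_twist hγ]
      exact (hsep0 ξ' η' hP' γ⁻¹ hγ' h').symm
    · exact hsep0 ξ η hP γ hγ (by rw [h])
    · obtain ⟨h₀, hQ⟩ := hmonic ξ η hP
      obtain ⟨h₀', hQ'⟩ := hmonic ξ' η' hP'
      have hinv := invariants_quarticOfPoint' h2 h3 ((cremona_equation_iff I J ξ η).mp hP.1)
      obtain ⟨R, hR⟩ := exists_basePoint_sub_eq_add_self h2 h3 hIJ rfl rfl rfl rfl hinv.1 hinv.2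
        hγ h h₀ h₀'
      rw [QuotientAddGroup.eq]
      refine ⟨R, ?_⟩
      rw [hφ, zsmulAddGroupHom_apply, two_zsmul, ← hR, hQ, hQ']
      abel
  -- the `s` pairwise disjoint soluble orbits
  set O : T → Finset (BinaryQuartic F) := fun t ↦ G.image fun γ ↦ twist γ (rep t.out) with hO
  have hOdisj : (Set.univ : Set T).PairwiseDisjoint O := by
    intro t _ t' _ htt'
    rw [Function.onFun, Finset.disjoint_left]
    intro g hg hg'
    apply htt'
    obtain ⟨γ, hγ, rfl⟩ := Finset.mem_image.mp hg
    obtain ⟨γ', hγ', hγγ'⟩ := Finset.mem_image.mp hg'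
    have hγd : γ.det ≠ 0 := (Finset.mem_filter.mp hγ).2
    have hγ'd : γ'.det ≠ 0 := (Finset.mem_filter.mp hγ').2
    have hu : IsUnit γ'.det := isUnit_iff_ne_zero.mpr hγ'd
    -- `γ'⁻¹ γ · rep(out t) = rep(out t')`
    have key : twist (γ'⁻¹ * γ) (rep t.out) = rep t'.out := by
      rw [twist_mul, ← hγγ', twist_inv_twist hγ'd]
    have hdet : (γ'⁻¹ * γ).det ≠ 0 := by
      rw [Matrix.det_mul]
      exact mul_ne_zero (Matrix.isUnit_nonsing_inv_det _ hu).ne_zero hγd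
    have := hsep _ _ _ hdet key
    rwa [QuotientAddGroup.out_eq', QuotientAddGroup.out_eq'] at this
  have hOsub : Finset.univ.biUnion O ⊆ X := by
    intro g hg
    obtain ⟨t, -, ht⟩ := Finset.mem_biUnion.mp hg
    exact hOrbX _ (hrepX _) ht
  have hOcard : (Finset.univ.biUnion O).card = X.card := by
    rw [Finset.card_biUnion (by simpa using hOdisj), hXcard]
    -- each orbit has `(q³ − q)/s` elements and there are `s` of them
    have hspos : 0 < s := by
      rw [hs, pgl2StabilizerCard_eq h2 h3 hΔ]; exact Nat.add_pos_left Nat.one_pos _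
    have hdvd : ∀ t, (O t).card = (Fintype.card F ^ 3 - Fintype.card F) / s := fun t ↦ by
      have := hOrbCard _ (hrepX t.out)
      rw [← this, Nat.mul_div_cancel _ hspos]
    rw [Finset.sum_congr rfl fun t _ ↦ hdvd t, Finset.sum_const, Finset.card_univ, hTcard,
      smul_eq_mul]
    have := hOrbCard _ (hrepX (0 : W.toAffine.Point))
    rw [← this, Nat.mul_div_cancel _ hspos, mul_comm]
  have hOX : Finset.univ.biUnion O = X := Finset.eq_of_subset_of_card_le hOsub hOcard.ge
  -- `f₀ ∈ X` lies in one of them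
  have hf₀ : f₀ ∈ X := Finset.mem_filter.mpr ⟨Finset.mem_univ _, rfl, rfl⟩
  rw [← hOX] at hf₀
  obtain ⟨t, -, ht⟩ := Finset.mem_biUnion.mp hf₀
  obtain ⟨γ, hγ, hγf⟩ := Finset.mem_image.mp ht
  rw [← hγf]
  exact (hrepSol _).twist (Finset.mem_filter.mp hγ).2

/-- The same statement through the invariants: over a finite field with `2, 3 ≠ 0`, every form with
`4I(f)³ ≠ J(f)²` is soluble. [cite: BhargavaShankarAnnals2015, Prop. 5.13 (arXiv:1006.1002v2 numbering)] -/
theorem isSoluble_of_four_I_cube_sub_J_sq_ne_zero (h2 : (2 : F) ≠ 0) (h3 : (3 : F) ≠ 0)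
    {f : BinaryQuartic F} (h : 4 * f.I ^ 3 - f.J ^ 2 ≠ 0) : f.IsSoluble := by
  refine isSoluble_of_disc_ne_zero_of_finite h2 h3 fun hΔ ↦ h ?_
  rw [← twentySeven_mul_disc, hΔ, mul_zero]

end Main

end BinaryQuartic

end Literature.NumberTheory.EllipticCurves

end
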